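import Mathlib.Analysis.SpecialFunctions.Complex.Circle
import Mathlib.MeasureTheory.Measure.Haar.Basic
import Mathlib.MeasureTheory.Group.Integral
import Mathlib.MeasureTheory.Constructions.Pi
import Literature.Probability.LatticeModels.GinibrePositiveKernels
import HarnessLib

/-!
# The XY (plane-rotator) model with quenched bond phases on a finite bond system

The finite-volume classical XY model with free boundary condition and a *quenched phase* `u_a ∈ U(1)`
on every bond, in the group-theoretic form used by Garban–Spencer (C. Garban, T. Spencer,
*Continuous symmetry breaking along the Nishimori line*, J. Math. Phys. **63** (2022) 093302,
arXiv:2109.01617, Definition 1 and (1.1)): spins `θ_v ∈ U(1)` (Mathlib's `Circle`) at the vertices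
of a finite set `V`, a finite family `ι` of oriented bonds `a : src a → tgt a`, the bond variable
`Y_a(θ, u) = u_a · θ̄_{src a} · θ_{tgt a}` (i.e. `e^{i(θ(tgt a) − θ(src a) + ω_a)}` for `u_a = e^{iω_a}`),
the Gibbs weight `exp (β ∑_a Re Y_a) = exp (β ∑_a cos(θ_{tgt a} − θ_{src a} + ω_a))` with respect to
the Haar probability measure `dθ = ∏_v dθ_v` of the torus `U(1)^V`, its partition function and the
(real and complex) Gibbs expectations `⟨F⟩_{u,β}`.  For `u ≡ 1` this is the pure XY model
`exp (β ∑_{bonds} cos(θ_i − θ_j)) ∏ dθ_i` ((1.1) of the source); Garban–Spencer's disordered model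
(their (1.3), summed over both orientations with a factor `½` and `ω_{ji} = −ω_{ij}`) is the same
weight written over one orientation per bond (footnote 1 of the source).

This file is the common vocabulary of the tree's proof of
`Literature.Probability.LatticeModels.GarbanSpencer2022_xyLongRangeOrder` (Nishimori gauge identity,
Messager–Miracle-Solé–Pfister inequality, path estimator); it contains definitions and elementary
API only (positivity of the partition function, normalisation, the bound `|⟨F⟩| ≤ sup |F|`, and the
gauge covariance `Y(θ, u · Y(φ,1)) = Y(θφ, u)` of the bond variables).

## Design

* `Circle` carries no `MeasurableSpace` instance in Mathlib at the tree's pin; as in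
  `Literature/MathematicalPhysics/QuantumLattice/HeatKernelGroup.lean` every measure-theoretic
  statement takes `[MeasurableSpace Circle] [BorelSpace Circle]` as instance *arguments* (a user
  supplies `borel Circle`), so that no global instance is declared here.
* `torusHaar α = Measure.pi (fun _ => haarMeasure ⊤)` is the Haar probability measure of `U(1)^α`
  (a Haar measure by `Measure.pi.isHaarMeasure`, of mass one by `haarMeasure_self`).
* Expectations are quotients of integrals (not `Measure.tilted`), the form in which the gauge
  and duplication arguments are computations with integrals.

## References

* C. Garban, T. Spencer, J. Math. Phys. 63 (2022) 093302, arXiv:2109.01617, §1.2.1, Def. 1,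
  (1.1)–(1.4). [GarbanSpencer2022]
* S. Friedli, Y. Velenik, *Statistical Mechanics of Lattice Systems* (CUP 2017), §9.1 (the XY /
  plane-rotator model). [FriedliVelenik2017]
-/

noncomputable section

open MeasureTheory Finset TopologicalSpace
open scoped BigOperators ComplexConjugate

namespace Literature.Probability.LatticeModels

/-! ### Bond systems -/

/-- A finite system of *oriented bonds* on a vertex set `V`: an index type `ι` of bonds with a
source and a target map.  (For the nearest-neighbour XY model on `Λ ⊂ ℤ^d` with free boundary
condition, `ι` is the set of edges with both endpoints in `Λ`, each with a chosen orientation;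
Garban–Spencer 2022, §1.2.1, "one may also choose a prescribed direction for each edge".)
[cite: GarbanSpencer2022, §1.2.1, Def. 1 and footnote 1] -/
structure BondSystem (V : Type*) (ι : Type*) where
  /-- the source vertex of a bond -/
  src : ι → V
  /-- the target vertex of a bond -/
  tgt : ι → V

/-! ### The Haar probability measure of the torus `U(1)^α` -/

section Haar

variable [MeasurableSpace Circle] [BorelSpace Circle]

/-- The Haar probability measure `∏_{i ∈ α} dθ_i` of the torus `U(1)^α` (normalised Lebesgue
measure in the angles), as the product of Mathlib's normalised Haar measures `haarMeasure ⊤` of the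
compact group `Circle` (Garban–Spencer 2022, (1.1): "we have normalized so that the integral over
`∏ dθ_j` is one"). [cite: GarbanSpencer2022, (1.1) and proof of Lemma 2.1] -/
def torusHaar (α : Type*) [Fintype α] : Measure (α → Circle) :=
  Measure.pi fun _ : α => Measure.haarMeasure (⊤ : PositiveCompacts Circle)

/-- Mathlib's normalised Haar measure of `U(1)` is a probability measure. [folklore] -/
instance isProbabilityMeasure_haarMeasure_circle_top :
    IsProbabilityMeasure (Measure.haarMeasure (⊤ : PositiveCompacts Circle)) :=
  ⟨by rw [← PositiveCompacts.coe_top]; exact Measure.haarMeasure_self⟩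

variable {α : Type*} [Fintype α]

/-- `torusHaar α` is a probability measure. [folklore] -/
instance torusHaar.instIsProbabilityMeasure : IsProbabilityMeasure (torusHaar α) := by
  unfold torusHaar; infer_instance

/-- `torusHaar α` is a Haar measure of the compact abelian group `U(1)^α`. [folklore] -/
instance torusHaar.instIsHaarMeasure : (torusHaar α).IsHaarMeasure := by
  unfold torusHaar; infer_instance

/-- `torusHaar α` is left invariant (translation invariance `dθ = d(φθ)`). [folklore] -/
instance torusHaar.instIsMulLeftInvariant : (torusHaar α).IsMulLeftInvariant := by
  unfold torusHaar; infer_instance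

/-- `torusHaar α` is right invariant. [folklore] -/
instance torusHaar.instIsMulRightInvariant : (torusHaar α).IsMulRightInvariant := by
  unfold torusHaar; infer_instance

/-- Translation invariance of the torus integral: `∫ F(θ φ) dθ = ∫ F(θ) dθ`. [folklore] -/
theorem integral_torusHaar_mul_right {E : Type*} [NormedAddCommGroup E] [NormedSpace ℝ E]
    (F : (α → Circle) → E) (φ : α → Circle) :
    ∫ θ, F (θ * φ) ∂torusHaar α = ∫ θ, F θ ∂torusHaar α :=
  integral_mul_right_eq_self F φ

omit [MeasurableSpace Circle] [BorelSpace Circle] [Fintype α] in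
/-- A continuous function with values in a normed group on a compact second-countable space is
integrable for every finite measure (vector-valued version of
`integrable_of_continuous_compactSpace`). [folklore] -/
theorem integrable_of_continuous_of_isFiniteMeasure {X E : Type*} [TopologicalSpace X]
    [CompactSpace X] [SecondCountableTopology X] [MeasurableSpace X] [OpensMeasurableSpace X]
    [NormedAddCommGroup E] (ν : Measure X) [IsFiniteMeasure ν] {g : X → E} (hg : Continuous g) :
    Integrable g ν := by
  obtain ⟨C, hC⟩ := isCompact_univ.exists_bound_of_continuousOn hg.continuousOn
  exact Integrable.of_bound hg.aestronglyMeasurable C (ae_of_all _ fun x => hC x (Set.mem_univ x))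

/-- A continuous function on the torus is integrable for `torusHaar`. [folklore] -/
theorem integrable_torusHaar_of_continuous {E : Type*} [NormedAddCommGroup E]
    {F : (α → Circle) → E} (hF : Continuous F) : Integrable F (torusHaar α) :=
  integrable_of_continuous_of_isFiniteMeasure _ hF

end Haar

/-! ### The two-point observable -/

section TwoPoint

variable {V : Type*}

/-- The two-point observable `Re (θ̄_x θ_y) = cos(θ(x) − θ(y))` of the XY model, as a function on
the torus (Garban–Spencer 2022, (1.2)). [cite: GarbanSpencer2022, (1.2)] -/
def cosDiff (x y : V) (θ : V → Circle) : ℝ :=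
  (conj ((θ x : Circle) : ℂ) * θ y).re

/-- `cos(θ(x) − θ(y))` is continuous on the torus. [folklore] -/
@[fun_prop]
theorem continuous_cosDiff (x y : V) : Continuous (cosDiff x y : (V → Circle) → ℝ) := by
  unfold cosDiff; fun_prop

/-- `|cos(θ(x) − θ(y))| ≤ 1`. [folklore] -/
theorem abs_cosDiff_le_one (x y : V) (θ : V → Circle) : |cosDiff x y θ| ≤ 1 := by
  unfold cosDiff
  refine (Complex.abs_re_le_norm _).trans ?_
  rw [norm_mul, Complex.norm_conj, Circle.norm_coe, Circle.norm_coe, one_mul]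

/-- `cos(θ(x) − θ(x)) = 1`. [folklore] -/
@[simp] theorem cosDiff_self (x : V) (θ : V → Circle) : cosDiff x x θ = 1 := by
  simp [cosDiff, ← Complex.normSq_eq_conj_mul_self, Complex.normSq_eq_norm_sq]

end TwoPoint

/-! ### Bond variables, energy, Gibbs weight -/

namespace BondSystem

variable {V ι : Type*} (G : BondSystem V ι)

/-- The bond variable `Y_a(θ, u) = u_a · θ̄_{src a} · θ_{tgt a} ∈ U(1)` of the bond `a` in the spin
configuration `θ` with bond phases `u` (`= e^{i(θ(tgt a) − θ(src a) + ω_a)}` for `u_a = e^{iω_a}`;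
Garban–Spencer 2022, (2.7)). [cite: GarbanSpencer2022, (2.7)] -/
def bondVar (u : ι → Circle) (θ : V → Circle) (a : ι) : Circle :=
  u a * (θ (G.src a))⁻¹ * θ (G.tgt a)

/-- `Y_a(θ, u)` as a complex number: `u_a · conj θ_{src a} · θ_{tgt a}`. [folklore] -/
theorem coe_bondVar (u : ι → Circle) (θ : V → Circle) (a : ι) :
    ((G.bondVar u θ a : Circle) : ℂ) = u a * conj ((θ (G.src a) : Circle) : ℂ) * θ (G.tgt a) := by
  rw [bondVar, Circle.coe_mul, Circle.coe_mul, Circle.coe_inv_eq_conj]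

/-- Without phases the bond variable is the relative angle `θ̄_{src a} θ_{tgt a}`. [folklore] -/
@[simp] theorem bondVar_one (θ : V → Circle) (a : ι) :
    G.bondVar 1 θ a = (θ (G.src a))⁻¹ * θ (G.tgt a) := by
  simp [bondVar]

/-- The bond variables with phases are the phases times the pure bond variables:
`Y(θ, u) = u · Y(θ, 1)`. [folklore] -/
theorem bondVar_eq_mul_bondVar_one (u : ι → Circle) (θ : V → Circle) :
    G.bondVar u θ = u * G.bondVar 1 θ := by
  funext a
  simp only [bondVar, Pi.mul_apply, Pi.one_apply, one_mul, mul_assoc]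

/-- **Gauge covariance of the bond variables**: shifting the phases by a pure gauge
`u ↦ u · Y(φ, 1)` is the same as rotating the spins sitewise, `θ ↦ θ φ`
(Garban–Spencer 2022, proof of Lemma 2.1, change of variables (2.2)). [cite: GarbanSpencer2022, proof of Lemma 2.1, (2.2)] -/
theorem bondVar_mul_bondVar_one (u : ι → Circle) (φ θ : V → Circle) :
    G.bondVar (u * G.bondVar 1 φ) θ = G.bondVar u (θ * φ) := by
  funext a
  simp only [bondVar, Pi.mul_apply, Pi.one_apply, one_mul, mul_inv]
  simp only [mul_assoc, mul_left_comm, mul_comm]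

/-- The inverse gauge shift by the spin configuration itself freezes the bond variables to the
phases: `Y(θ, u · Y(θ,1)⁻¹) = u` (Garban–Spencer 2022, proof of Lemma 2.1, last step of (2.4)).
[cite: GarbanSpencer2022, proof of Lemma 2.1, (2.4)] -/
theorem bondVar_mul_inv_bondVar_one (u : ι → Circle) (θ : V → Circle) :
    G.bondVar (u * (G.bondVar 1 θ)⁻¹) θ = u := by
  funext a
  simp only [bondVar, Pi.mul_apply, Pi.inv_apply, Pi.one_apply]
  group

/-- The bond variable is jointly continuous in `(u, θ)`. [folklore] -/
theorem continuous_bondVar_uncurry (a : ι) :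
    Continuous fun p : (ι → Circle) × (V → Circle) => G.bondVar p.1 p.2 a := by
  unfold bondVar; fun_prop

/-- The bond variable is continuous in the spins. [folklore] -/
@[fun_prop]
theorem continuous_bondVar (u : ι → Circle) (a : ι) : Continuous fun θ : V → Circle => G.bondVar u θ a := by
  unfold bondVar; fun_prop

variable [Fintype ι]

/-- The (negative) energy `∑_a Re Y_a(θ, u) = ∑_a cos(θ(tgt a) − θ(src a) + ω_a)` of the XY model
with bond phases `u` (Garban–Spencer 2022, exponent of (1.3), one orientation per bond). [cite: GarbanSpencer2022, (1.3)] -/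
def energy (u : ι → Circle) (θ : V → Circle) : ℝ :=
  ∑ a, ((G.bondVar u θ a : Circle) : ℂ).re

/-- The energy of the pure XY model is `∑_a cos(θ(src a) − θ(tgt a))`, i.e.
`∑_a Re (conj θ_{src a} · θ_{tgt a})` (Garban–Spencer 2022, (1.1)). [cite: GarbanSpencer2022, (1.1)] -/
theorem energy_one (θ : V → Circle) :
    G.energy 1 θ = ∑ a, (conj ((θ (G.src a) : Circle) : ℂ) * θ (G.tgt a)).re := by
  simp [energy]

/-- `|∑_a Re Y_a| ≤ |ι|`. [folklore] -/
theorem abs_energy_le (u : ι → Circle) (θ : V → Circle) : |G.energy u θ| ≤ Fintype.card ι := by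
  unfold energy
  refine (Finset.abs_sum_le_sum_abs _ _).trans ?_
  calc ∑ a, |((G.bondVar u θ a : Circle) : ℂ).re| ≤ ∑ _a : ι, (1 : ℝ) :=
        Finset.sum_le_sum fun a _ => (Complex.abs_re_le_norm _).trans_eq (Circle.norm_coe _)
    _ = Fintype.card ι := by simp

/-- The energy is jointly continuous in `(u, θ)`. [folklore] -/
theorem continuous_energy_uncurry :
    Continuous fun p : (ι → Circle) × (V → Circle) => G.energy p.1 p.2 := by
  unfold energy
  refine continuous_finsetSum _ fun a _ => ?_
  exact Complex.continuous_re.comp (continuous_subtype_val.comp (G.continuous_bondVar_uncurry a))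

/-- The energy is continuous in the spins. [folklore] -/
theorem continuous_energy (u : ι → Circle) : Continuous (G.energy u) := by
  unfold energy
  refine continuous_finsetSum _ fun a _ => ?_
  exact Complex.continuous_re.comp (continuous_subtype_val.comp (G.continuous_bondVar u a))

/-- The Gibbs weight `exp (β ∑_a Re Y_a(θ, u))` of the XY model with bond phases `u` at inverse
temperature `β` (Garban–Spencer 2022, (1.3); for `u ≡ 1` the pure weight (1.1)). [cite: GarbanSpencer2022, (1.1) and (1.3)] -/
def weight (β : ℝ) (u : ι → Circle) (θ : V → Circle) : ℝ :=
  Real.exp (β * G.energy u θ)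

/-- The Gibbs weight is positive. [folklore] -/
theorem weight_pos (β : ℝ) (u : ι → Circle) (θ : V → Circle) : 0 < G.weight β u θ :=
  Real.exp_pos _

/-- The Gibbs weight is bounded by `exp (|β| |ι|)`. [folklore] -/
theorem weight_le (β : ℝ) (u : ι → Circle) (θ : V → Circle) :
    G.weight β u θ ≤ Real.exp (|β| * Fintype.card ι) := by
  refine Real.exp_le_exp.2 ((le_abs_self _).trans ?_)
  rw [abs_mul]
  exact mul_le_mul_of_nonneg_left (G.abs_energy_le u θ) (abs_nonneg β)

/-- The Gibbs weight is jointly continuous in `(u, θ)`. [folklore] -/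
theorem continuous_weight_uncurry (β : ℝ) :
    Continuous fun p : (ι → Circle) × (V → Circle) => G.weight β p.1 p.2 :=
  Real.continuous_exp.comp (continuous_const.mul G.continuous_energy_uncurry)

/-- The Gibbs weight is continuous in the spins. [folklore] -/
theorem continuous_weight (β : ℝ) (u : ι → Circle) : Continuous (G.weight β u) := by
  unfold weight
  exact Real.continuous_exp.comp (continuous_const.mul (G.continuous_energy u))

/-- Gauge covariance of the weight: `w(u · Y(φ,1), θ) = w(u, θφ)`. [cite: GarbanSpencer2022, proof of Lemma 2.1, (2.2)] -/
theorem weight_mul_bondVar_one (β : ℝ) (u : ι → Circle) (φ θ : V → Circle) :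
    G.weight β (u * G.bondVar 1 φ) θ = G.weight β u (θ * φ) := by
  simp [weight, energy, bondVar_mul_bondVar_one]

/-! ### Partition function and Gibbs expectations -/

variable [Fintype V] [MeasurableSpace Circle] [BorelSpace Circle]

/-- The partition function `Z_{u,β} = ∫ exp (β ∑_a Re Y_a(θ,u)) dθ` (Garban–Spencer 2022, (1.4)).
[cite: GarbanSpencer2022, (1.4)] -/
def partitionFn (β : ℝ) (u : ι → Circle) : ℝ :=
  ∫ θ, G.weight β u θ ∂torusHaar V

/-- The (real) Gibbs expectation `⟨f⟩_{u,β} = Z⁻¹ ∫ f(θ) exp (β ∑_a Re Y_a) dθ` of the XY model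
with bond phases `u` (Garban–Spencer 2022, (1.4)). [cite: GarbanSpencer2022, (1.4)] -/
def expect (β : ℝ) (u : ι → Circle) (f : (V → Circle) → ℝ) : ℝ :=
  (∫ θ, f θ * G.weight β u θ ∂torusHaar V) / G.partitionFn β u

/-- The complex Gibbs expectation `⟨F⟩_{u,β}` of a complex observable (Garban–Spencer 2022, (1.4),
used for `F = e^{i(θ(0) − θ(n))}` in (2.8)). [cite: GarbanSpencer2022, (1.4) and (2.8)] -/
def cexpect (β : ℝ) (u : ι → Circle) (F : (V → Circle) → ℂ) : ℂ :=
  (∫ θ, F θ * G.weight β u θ ∂torusHaar V) / G.partitionFn β u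

/-- The Gibbs weight is integrable. [folklore] -/
theorem integrable_weight (β : ℝ) (u : ι → Circle) : Integrable (G.weight β u) (torusHaar V) :=
  integrable_torusHaar_of_continuous (G.continuous_weight β u)

/-- The partition function is positive. [folklore] -/
theorem partitionFn_pos (β : ℝ) (u : ι → Circle) : 0 < G.partitionFn β u :=
  integral_exp_pos (G.integrable_weight β u)

/-- Gauge invariance of the partition function: `Z_{u · Y(φ,1)} = Z_u` (change of variables
`θ ↦ θφ`; Garban–Spencer 2022, proof of Lemma 2.1). [cite: GarbanSpencer2022, proof of Lemma 2.1, (2.2)–(2.3)] -/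
theorem partitionFn_mul_bondVar_one (β : ℝ) (u : ι → Circle) (φ : V → Circle) :
    G.partitionFn β (u * G.bondVar 1 φ) = G.partitionFn β u := by
  simp only [partitionFn, weight_mul_bondVar_one]
  exact integral_torusHaar_mul_right (G.weight β u) φ

/-- `⟨1⟩ = 1`. [folklore] -/
@[simp] theorem expect_one (β : ℝ) (u : ι → Circle) : G.expect β u (fun _ => 1) = 1 := by
  simp only [expect, one_mul]
  exact div_self (G.partitionFn_pos β u).ne'

/-- `⟨1⟩ = 1` (complex observable). [folklore] -/
@[simp] theorem cexpect_one (β : ℝ) (u : ι → Circle) : G.cexpect β u (fun _ => 1) = 1 := by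
  have h := (G.partitionFn_pos β u).ne'
  simp only [cexpect, one_mul, partitionFn] at h ⊢
  rw [integral_complex_ofReal, div_self]
  exact_mod_cast h

/-- A real observable's complex expectation is its real expectation. [folklore] -/
theorem cexpect_ofReal (β : ℝ) (u : ι → Circle) (f : (V → Circle) → ℝ) :
    G.cexpect β u (fun θ => (f θ : ℂ)) = (G.expect β u f : ℂ) := by
  simp only [cexpect, expect, ← Complex.ofReal_mul, Complex.ofReal_div]
  rw [integral_complex_ofReal]

/-- The real part of a complex expectation is the expectation of the real part (for an integrable,
e.g. continuous, observable). [folklore] -/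
theorem re_cexpect (β : ℝ) (u : ι → Circle) {F : (V → Circle) → ℂ} (hF : Continuous F) :
    (G.cexpect β u F).re = G.expect β u (fun θ => (F θ).re) := by
  have hi : Integrable (fun θ => F θ * G.weight β u θ) (torusHaar V) :=
    integrable_torusHaar_of_continuous (hF.mul (Complex.continuous_ofReal.comp (G.continuous_weight β u)))
  have h2 := integral_re hi
  simp only [RCLike.re_to_complex] at h2
  rw [cexpect, expect, Complex.div_ofReal_re, ← h2]
  congr 1
  refine integral_congr_ae (ae_of_all _ fun θ => ?_)
  simp [Complex.mul_re]

/-- **`|⟨F⟩| ≤ sup |F|`**: the Gibbs expectation of a bounded continuous observable is bounded by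
its sup norm. [folklore] -/
theorem norm_cexpect_le (β : ℝ) (u : ι → Circle) (F : (V → Circle) → ℂ) {C : ℝ}
    (hC : ∀ θ, ‖F θ‖ ≤ C) : ‖G.cexpect β u F‖ ≤ C := by
  have hZ := G.partitionFn_pos β u
  have hC0 : 0 ≤ C := (norm_nonneg _).trans (hC 1)
  rw [cexpect, norm_div, Complex.norm_real, Real.norm_of_nonneg hZ.le, div_le_iff₀ hZ]
  calc ‖∫ θ, F θ * G.weight β u θ ∂torusHaar V‖
      ≤ ∫ θ, ‖F θ * (G.weight β u θ : ℂ)‖ ∂torusHaar V := norm_integral_le_integral_norm _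
    _ ≤ ∫ θ, C * G.weight β u θ ∂torusHaar V := by
        refine integral_mono_of_nonneg (ae_of_all _ fun _ => norm_nonneg _)
          ((G.integrable_weight β u).const_mul C) (ae_of_all _ fun θ => ?_)
        show ‖F θ * (G.weight β u θ : ℂ)‖ ≤ C * G.weight β u θ
        rw [norm_mul, Complex.norm_real, Real.norm_of_nonneg (G.weight_pos β u θ).le]
        exact mul_le_mul_of_nonneg_right (hC θ) (G.weight_pos β u θ).le
    _ = C * G.partitionFn β u := by rw [integral_const_mul]; rfl

/-- `|⟨f⟩| ≤ sup |f|` for a real observable. [folklore] -/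
theorem abs_expect_le (β : ℝ) (u : ι → Circle) (f : (V → Circle) → ℝ) {C : ℝ}
    (hC : ∀ θ, |f θ| ≤ C) : |G.expect β u f| ≤ C := by
  have h := G.norm_cexpect_le β u (fun θ => (f θ : ℂ))
    (fun θ => by rw [Complex.norm_real, Real.norm_eq_abs]; exact hC θ)
  rwa [cexpect_ofReal, Complex.norm_real, Real.norm_eq_abs] at h

/-- Gauge covariance of expectations: `⟨F⟩_{u · Y(φ,1)} = ⟨F(· φ⁻¹)⟩_u`, i.e. shifting the phases
by a pure gauge equals rotating the observable (Garban–Spencer 2022, proof of Lemma 2.1, (2.2)–(2.3)).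
[cite: GarbanSpencer2022, proof of Lemma 2.1, (2.2)–(2.3)] -/
theorem cexpect_mul_bondVar_one (β : ℝ) (u : ι → Circle) (φ : V → Circle) (F : (V → Circle) → ℂ) :
    G.cexpect β (u * G.bondVar 1 φ) F = G.cexpect β u (fun θ => F (θ * φ⁻¹)) := by
  rw [cexpect, cexpect, partitionFn_mul_bondVar_one]
  congr 1
  simp only [weight_mul_bondVar_one]
  have h := integral_torusHaar_mul_right (fun θ => F (θ * φ⁻¹) * (G.weight β u θ : ℂ)) φ
  simpa only [mul_inv_cancel_right] using h

/-- The spin–spin correlation `⟨cos(θ(x) − θ(y))⟩_{u,β}` is at most `1` in absolute value. [folklore] -/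
theorem abs_expect_cosDiff_le_one (β : ℝ) (u : ι → Circle) (x y : V) :
    |G.expect β u (cosDiff x y)| ≤ 1 :=
  G.abs_expect_le β u (cosDiff x y) (abs_cosDiff_le_one x y)

end BondSystem

end Literature.Probability.LatticeModels
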